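import Summits.QuantumFields.YangMills.Theses.FradkinShenkerFlow
import Summits.QuantumFields.YangMills.Theorems.FradkinShenkerFlowSusceptibilityToPoincareRestatement

/-!
# `SusceptibilityToPoincare` — split glue (crux-strategist decomposition of stmt-QuantumFields-9441)

Support for crux `stmt-QuantumFields-9441`
(`Summit.QuantumFields.YangMills.Theses.FradkinShenkerFlow.SusceptibilityToPoincare`: for every compact simple `G`,
faithful unitary `r`, `β ≥ 0`, finite gauge-invariant susceptibility FS(r, β) of the torus Wilson measures ⇒ the
uniform single-link heat-bath Poincaré inequality UP(r, β)).

This file is the GLUE of the strategist's decomposition of the crux into two sub-cruxes (D-0027 A7, one layer,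
`route edit --split SusceptibilityToPoincare --into … --glue-by`):

* **Sub₁ = `SusceptibilityToPoincareSC`** (the weak-coupling simply-connected core C″ — the consensus restatement of ten
  lead / disprover / triage seats, `Cruxes/SusceptibilityToPoincare/NOTES.md`):
  `IsCompactSimpleLieGroup G → SimplyConnectedSpace G → ∀ r, ∃ β₁, ∀ β ≥ β₁, FS r β → UP r β`.  Believed TRUE and
  summit-hard (Bałaban-grade fluctuation Poincaré + "ξ(β) < ∞ in RG clothing", line `rg-variance-cascade` stubs B–D);
  it is the ONLY part of the crux the deciding theorem of the route needs for simply-connected `G`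
  (`Restatement.closes_restated`, p127070).
* **Sub₂ = `SusceptibilityToPoincareResidual`** (the scope residual T — "the typed decl follows from its core"):
  `IsCompactSimpleLieGroup G → ∀ r, (SimplyConnectedSpace G → ∃ β₁, ∀ β ≥ β₁, FS r β → UP r β) → ∀ β ≥ 0, FS r β → UP r β`.
  For centreless `G` its hypothesis is vacuous (it is "FS ⇒ UP at every β ≥ 0", refuted modulo the 't Hooft
  twist-sector inputs, `Negative.typedDeclResidual_false_of_twistInputs_centreless`); for simply-connected `G` it is the
  removal of the threshold `β₁` (refuted modulo the Bhanot–Creutz phase-II twist inputs at `SU(2)` together with C″ at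
  `SU(2)`, `Negative.typedDeclResidual_false_of_twistInputsSU2`).  Believed FALSE; a disprover item.

`susceptibilityToPoincare_of_subs : Sub₁ → Sub₂ → SusceptibilityToPoincare` is the curried `.mpr` of the landed
`Restatement.crux_iff_coreSC_and_residual` (p127070: crux ⟺ Sub₁ ∧ Sub₂), so the split is EXACT (no strength is lost or
added): the two children are jointly equivalent to the parent, Sub₁ strictly weaker and believed true, Sub₂ strictly weaker
and conditionally refuted.  Pure logic over the route's definitions; FS / UP are spelled verbatim in the `:=`-free
ascription spelling `(wilsonMeasure r.ρ β : Measure (GaugeConfig 4 (2 * S + 1) G))` of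
`wilsonMeasure (d := 4) (L := 2 * S + 1) r.ρ β` (the same term, as in the Restatement file).
-/

noncomputable section

open MeasureTheory ProbabilityTheory Filter Topology
open Literature.MathematicalPhysics.QuantumFieldTheory

namespace Summit.QuantumFields.YangMills.Theorems.SusceptibilityToPoincare.Split

/-- **Split glue `SusceptibilityToPoincare_of_subs`**: the weak-coupling simply-connected core C″ (Sub₁) and the scope
residual T (Sub₂) together give crux 9441 as typed — for `G, r, β ≥ 0` with FS, T applied to C″ (its hypothesis, used
only when `G` is simply connected) returns UP.  Curried right-to-left direction of
`Restatement.crux_iff_coreSC_and_residual`. [folklore] -/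
theorem susceptibilityToPoincare_of_subs :
    (∀ (G : Type) [Group G] [TopologicalSpace G] [IsTopologicalGroup G] [CompactSpace G]
        [MeasurableSpace G] [BorelSpace G], IsCompactSimpleLieGroup G → SimplyConnectedSpace G →
        ∀ (r : LatticeRep G), ∃ β₁ : ℝ, ∀ β : ℝ, β₁ ≤ β →
        (∀ A B : YMSpecies G, ∃ χ : ℝ, ∀ S : ℕ, ∑ x ∈ Literature.Probability.LatticeModels.box 4 S,
          |covariance (fun U => A.F (Literature.MathematicalPhysics.QuantumLattice.torusLift (2 * S + 1) U))
            (fun U => B.F (Literature.MathematicalPhysics.QuantumLattice.configShift (-x)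
            (Literature.MathematicalPhysics.QuantumLattice.torusLift (2 * S + 1) U)))
            (wilsonMeasure r.ρ β : Measure (GaugeConfig 4 (2 * S + 1) G))| ≤ χ) →
        (∃ C : ℝ, ∀ S : ℕ, ∀ F : GaugeConfig 4 (2 * S + 1) G → ℝ, Measurable F → (∃ M : ℝ, ∀ U, |F U| ≤ M) →
          variance F (wilsonMeasure r.ρ β : Measure (GaugeConfig 4 (2 * S + 1) G)) ≤
            C * ∑ ℓ : Edge 4 (2 * S + 1), ∫ U, ∫ g, (F U - F (Function.update U ℓ g)) ^ 2
              ∂((haarProbability G).tilted (fun g' => -β * wilsonAction r.ρ (Function.update U ℓ g')))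
              ∂(wilsonMeasure r.ρ β : Measure (GaugeConfig 4 (2 * S + 1) G)))) →
    (∀ (G : Type) [Group G] [TopologicalSpace G] [IsTopologicalGroup G] [CompactSpace G]
        [MeasurableSpace G] [BorelSpace G], IsCompactSimpleLieGroup G → ∀ (r : LatticeRep G),
        (SimplyConnectedSpace G → ∃ β₁ : ℝ, ∀ β : ℝ, β₁ ≤ β →
        (∀ A B : YMSpecies G, ∃ χ : ℝ, ∀ S : ℕ, ∑ x ∈ Literature.Probability.LatticeModels.box 4 S,
          |covariance (fun U => A.F (Literature.MathematicalPhysics.QuantumLattice.torusLift (2 * S + 1) U))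
            (fun U => B.F (Literature.MathematicalPhysics.QuantumLattice.configShift (-x)
            (Literature.MathematicalPhysics.QuantumLattice.torusLift (2 * S + 1) U)))
            (wilsonMeasure r.ρ β : Measure (GaugeConfig 4 (2 * S + 1) G))| ≤ χ) →
        (∃ C : ℝ, ∀ S : ℕ, ∀ F : GaugeConfig 4 (2 * S + 1) G → ℝ, Measurable F → (∃ M : ℝ, ∀ U, |F U| ≤ M) →
          variance F (wilsonMeasure r.ρ β : Measure (GaugeConfig 4 (2 * S + 1) G)) ≤
            C * ∑ ℓ : Edge 4 (2 * S + 1), ∫ U, ∫ g, (F U - F (Function.update U ℓ g)) ^ 2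
              ∂((haarProbability G).tilted (fun g' => -β * wilsonAction r.ρ (Function.update U ℓ g')))
              ∂(wilsonMeasure r.ρ β : Measure (GaugeConfig 4 (2 * S + 1) G)))) →
        ∀ β : ℝ, 0 ≤ β →
        (∀ A B : YMSpecies G, ∃ χ : ℝ, ∀ S : ℕ, ∑ x ∈ Literature.Probability.LatticeModels.box 4 S,
          |covariance (fun U => A.F (Literature.MathematicalPhysics.QuantumLattice.torusLift (2 * S + 1) U))
            (fun U => B.F (Literature.MathematicalPhysics.QuantumLattice.configShift (-x)
            (Literature.MathematicalPhysics.QuantumLattice.torusLift (2 * S + 1) U)))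
            (wilsonMeasure r.ρ β : Measure (GaugeConfig 4 (2 * S + 1) G))| ≤ χ) →
        (∃ C : ℝ, ∀ S : ℕ, ∀ F : GaugeConfig 4 (2 * S + 1) G → ℝ, Measurable F → (∃ M : ℝ, ∀ U, |F U| ≤ M) →
          variance F (wilsonMeasure r.ρ β : Measure (GaugeConfig 4 (2 * S + 1) G)) ≤
            C * ∑ ℓ : Edge 4 (2 * S + 1), ∫ U, ∫ g, (F U - F (Function.update U ℓ g)) ^ 2
              ∂((haarProbability G).tilted (fun g' => -β * wilsonAction r.ρ (Function.update U ℓ g')))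
              ∂(wilsonMeasure r.ρ β : Measure (GaugeConfig 4 (2 * S + 1) G)))) →
    Summit.QuantumFields.YangMills.Theses.FradkinShenkerFlow.SusceptibilityToPoincare := by
  intro hC hT
  exact Summit.QuantumFields.YangMills.Theorems.SusceptibilityToPoincare.Restatement.crux_iff_coreSC_and_residual.mpr
    ⟨hC, hT⟩

/-- The same glue, proved DIRECTLY (no use of the restatement package): for `G, r, β ≥ 0` with FS, the residual
applied to the core (its hypothesis) returns UP.  Recorded so that the split's soundness does not depend on any other
file of the line. [folklore] -/
theorem susceptibilityToPoincare_of_subs' :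
    (∀ (G : Type) [Group G] [TopologicalSpace G] [IsTopologicalGroup G] [CompactSpace G]
        [MeasurableSpace G] [BorelSpace G], IsCompactSimpleLieGroup G → SimplyConnectedSpace G →
        ∀ (r : LatticeRep G), ∃ β₁ : ℝ, ∀ β : ℝ, β₁ ≤ β →
        (∀ A B : YMSpecies G, ∃ χ : ℝ, ∀ S : ℕ, ∑ x ∈ Literature.Probability.LatticeModels.box 4 S,
          |covariance (fun U => A.F (Literature.MathematicalPhysics.QuantumLattice.torusLift (2 * S + 1) U))
            (fun U => B.F (Literature.MathematicalPhysics.QuantumLattice.configShift (-x)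
            (Literature.MathematicalPhysics.QuantumLattice.torusLift (2 * S + 1) U)))
            (wilsonMeasure r.ρ β : Measure (GaugeConfig 4 (2 * S + 1) G))| ≤ χ) →
        (∃ C : ℝ, ∀ S : ℕ, ∀ F : GaugeConfig 4 (2 * S + 1) G → ℝ, Measurable F → (∃ M : ℝ, ∀ U, |F U| ≤ M) →
          variance F (wilsonMeasure r.ρ β : Measure (GaugeConfig 4 (2 * S + 1) G)) ≤
            C * ∑ ℓ : Edge 4 (2 * S + 1), ∫ U, ∫ g, (F U - F (Function.update U ℓ g)) ^ 2
              ∂((haarProbability G).tilted (fun g' => -β * wilsonAction r.ρ (Function.update U ℓ g')))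
              ∂(wilsonMeasure r.ρ β : Measure (GaugeConfig 4 (2 * S + 1) G)))) →
    (∀ (G : Type) [Group G] [TopologicalSpace G] [IsTopologicalGroup G] [CompactSpace G]
        [MeasurableSpace G] [BorelSpace G], IsCompactSimpleLieGroup G → ∀ (r : LatticeRep G),
        (SimplyConnectedSpace G → ∃ β₁ : ℝ, ∀ β : ℝ, β₁ ≤ β →
        (∀ A B : YMSpecies G, ∃ χ : ℝ, ∀ S : ℕ, ∑ x ∈ Literature.Probability.LatticeModels.box 4 S,
          |covariance (fun U => A.F (Literature.MathematicalPhysics.QuantumLattice.torusLift (2 * S + 1) U))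
            (fun U => B.F (Literature.MathematicalPhysics.QuantumLattice.configShift (-x)
            (Literature.MathematicalPhysics.QuantumLattice.torusLift (2 * S + 1) U)))
            (wilsonMeasure r.ρ β : Measure (GaugeConfig 4 (2 * S + 1) G))| ≤ χ) →
        (∃ C : ℝ, ∀ S : ℕ, ∀ F : GaugeConfig 4 (2 * S + 1) G → ℝ, Measurable F → (∃ M : ℝ, ∀ U, |F U| ≤ M) →
          variance F (wilsonMeasure r.ρ β : Measure (GaugeConfig 4 (2 * S + 1) G)) ≤
            C * ∑ ℓ : Edge 4 (2 * S + 1), ∫ U, ∫ g, (F U - F (Function.update U ℓ g)) ^ 2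
              ∂((haarProbability G).tilted (fun g' => -β * wilsonAction r.ρ (Function.update U ℓ g')))
              ∂(wilsonMeasure r.ρ β : Measure (GaugeConfig 4 (2 * S + 1) G)))) →
        ∀ β : ℝ, 0 ≤ β →
        (∀ A B : YMSpecies G, ∃ χ : ℝ, ∀ S : ℕ, ∑ x ∈ Literature.Probability.LatticeModels.box 4 S,
          |covariance (fun U => A.F (Literature.MathematicalPhysics.QuantumLattice.torusLift (2 * S + 1) U))
            (fun U => B.F (Literature.MathematicalPhysics.QuantumLattice.configShift (-x)
            (Literature.MathematicalPhysics.QuantumLattice.torusLift (2 * S + 1) U)))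
            (wilsonMeasure r.ρ β : Measure (GaugeConfig 4 (2 * S + 1) G))| ≤ χ) →
        (∃ C : ℝ, ∀ S : ℕ, ∀ F : GaugeConfig 4 (2 * S + 1) G → ℝ, Measurable F → (∃ M : ℝ, ∀ U, |F U| ≤ M) →
          variance F (wilsonMeasure r.ρ β : Measure (GaugeConfig 4 (2 * S + 1) G)) ≤
            C * ∑ ℓ : Edge 4 (2 * S + 1), ∫ U, ∫ g, (F U - F (Function.update U ℓ g)) ^ 2
              ∂((haarProbability G).tilted (fun g' => -β * wilsonAction r.ρ (Function.update U ℓ g')))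
              ∂(wilsonMeasure r.ρ β : Measure (GaugeConfig 4 (2 * S + 1) G)))) →
    Summit.QuantumFields.YangMills.Theses.FradkinShenkerFlow.SusceptibilityToPoincare := by
  intro hC hT G _ _ _ _ _ _ hG r β hβ hFS
  exact hT G hG r (fun hsc => hC G hG hsc r) β hβ hFS

end Summit.QuantumFields.YangMills.Theorems.SusceptibilityToPoincare.Split

end
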